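import Summits.QuantumFields.YangMills.Theorems.BalabanUVNodesN15TwoSpacingGluingCurvedKnitCovariantAveragingTransfer
import Summits.QuantumFields.YangMills.Theorems.BalabanUVNodesN15TwoSpacingGluingCurvedKnitSmallFieldNodeObjects
import HarnessLib

/-!
# N15 = NE2 — PROGRAMME Q, part (Q-6a): THE CONSTRUCTED AVERAGING PERTURBATION FAMILY OF dag-n15-c's `Q(U)` — `D := Q_{T(A′)} − Q⊗1`, `E := Q*_{T(A′)} − Q*⊗1` at both spacings — AND ITS FOUR
# SIZE ROWS in (Q-3)'s displayed shape `K_D·(c₃₅L^mα₀)·e^{−ρd}` ([B9] (3.81): `|F_{2,j}(A)A′| ≤ O(1)α₁Q″_j|A′|`), from n15-c∕181∕182∕187a BY NAME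
# (dag-n15-a g31, FILE (Q-6a); node N15 = NE2; `--supports stmt-QuantumFields-27366 --as helper`, count-neutral; 6 plumbing defs + theorems; imports n15-c∕187a)

WHY.  (Q-3)∕(Q-4)∕(Q-5)∕(∂-2) prove the site∕unit layers and the all-live knit for EVERY averaging-perturbation family with DISPLAYED rows `hfam`.  dag-n15-c g21 CONSTRUCTED the covariant
averaging: 181 `qvCov M n T`∕`qvCovAdj` (main term (125) of [5] (124): block-line averages with the transports `cvaPath T` along staircase+line contours; `qvCov_one = tensorId ι (qvRe M n)`),
182 `hasMaj_qvCov_sub_one`∕`hasMaj_qvCovAdj_sub_one` (`Q(U) − Q(1) ≤ ((1+ρ_T)^{(d+2)n} − 1)e^{ρ′}e^{−ρ′d}` once every transporter is `ρ_T`-close to `1` in rows∕columns), 187a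
`sf_rows∕cols_cvT_exp_sub_one_le` (for `T = cvT e (e^{ηA})`, skew `A` with `‖A‖ ≤ r_A`: `ρ_T = |ι|·κ_e·2√m·√m·(e^{ηr_A} − 1)`).  This file NAMES the family at dag-n15-c's small-field
pair (`T_c(A′) = cvT e (e^{ηĀ′})`, `Ā′` the block mean, coarse; `T_f(A′) = cvT e (e^{η′A′})`, fine) and proves the four SIZE rows of `hfam` with `K_D` LINEAR in `r_A = c₃₅L^mα₀` in the window
`r_A ≤ 1`: `(1+ρ_T)^{(d+2)n} − 1 ≤ (d+2)nρ_T·e^{(d+2)nρ_T}` and `nη = 1` turn the exponential of 182 into `K·r_A` (§1).  The two COMPARISON rows (184a∕184b + 185c) are (Q-6b).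

WHAT.  §1 scalar: (private `exp_sub_one_le_mul_exp`), `pow_sub_one_le_mul_exp`, §1b ★ `l2_opNorm_le_frobeniusNorm` (`‖M‖_{op} ≤ ‖M‖_F`: the class `Reg335` is Frobenius, 187a's letter is
L²-operator), ★ `transport_size_le` (`((1+ρ_T)^{(d+2)n} − 1) ≤ K_Q·r_A` from `ρ_T ≤ C(e^{ηr_A} − 1)`, `nη = 1`, `η ≤ 1`, `0 ≤ r_A ≤ 1`, with
`K_Q := (d+2)·C·e·e^{(d+2)·C·e}`).  §2 defs `qTc`∕`qTf` (transporter data), `qDc`∕`qEc`∕`qDf`∕`qEf` (the family); `qDc_eq`∕`qEc_eq`∕`qDf_eq`∕`qEf_eq` (= `qvCov T − qvCov 1` etc., by `qvCov_one`).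
§3 ★★ `hasMaj_qDc`, `hasMaj_qEc`, `hasMaj_qDf`, `hasMaj_qEf`: under `Reg335 c₃₅ α₀ A′` with `c₃₅L^mα₀ ≤ 1`, at every rate `ρ ≥ 0`, the four size rows with the constant
`K_Q(d, |ι|κ_e2√m√m)·e^{ρ}·(c₃₅L^mα₀)`.

HONEST FRAMING ∕ LIMITS.  Bookkeeping over dag-n15-c's constructed objects and letters (their MODEL reading: main term (125) of (124) only — the `O(L²α₀)` remainder terms of (124) omitted;
one-level staircase contours; global small-field gauge); no layer of NE2 proved here; NOT [B9] (3.78)–(3.81) AS PRINTED (the print's `F_{2,j}` is the full (124)'s); N15 stays DISCHARGED OF RECORD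
AS CONSUMED (U-blind v7 pin, p687738), nothing re-claimed, no count moved; finite 𝕋⁴ per index — NOT ℝ⁴ ∕ OS ∕ mass gap ∕ Clay.  Six plumbing `def`s ⇒ review ∕ audit lane.  No `sorry`,
`instance`, `notation`, `set_option`; standard axioms.
[cite: Balaban1985BackgroundPropagators, (3.78)–(3.81) p.406, (3.13)–(3.15) pp.392–393, (3.35) p.396; Balaban1985Averaging, (125)–(126) p.36 (main term), (139)–(143) p.39; Balaban1984PropagatorsI, (1.18) p.20]
-/

noncomputable section

open scoped BigOperators Matrix

namespace Summit.QuantumFields.YangMills.BalabanUVNodes.N15.SiteLayerSf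

open Literature.MathematicalPhysics.QuantumFieldTheory.Balaban1983to89
open Literature.MathematicalPhysics.QuantumFieldTheory.Balaban1983to89.B11SectG (BlockNorm HasMaj)
open Literature.MathematicalPhysics.QuantumFieldTheory.Balaban1983to89.B5Prop11Plancherel (Tor fine)
open Literature.MathematicalPhysics.QuantumFieldTheory.Balaban1983to89.B6UnitTorusCarrier (unitTorusGeo unitTorusGeo_dist_nonneg)
open Literature.MathematicalPhysics.QuantumFieldTheory.King1986.Torus (blockOf tdistT)
open Literature.Barriers.QuantumFields (traceForm)
open Summit.QuantumFields.YangMills.BalabanUVNodes.N15.BackgroundLayer (gavgM)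
open Summit.QuantumFields.YangMills.BalabanUVNodes.N15.VectorPiece (bshiftEquiv kingPrV tensorId)
open Summit.QuantumFields.YangMills.BalabanUVNodes.N15.MatrixSpecies (basisConst basisConst_nonneg liftBlk liftMap norm_blockAvgV_le)
open Summit.QuantumFields.YangMills.BalabanUVNodes.N15.TwoGrid (qvRe qvAdjRe)
open Summit.QuantumFields.YangMills.BalabanUVNodes.N15.Gluing (SfIdx sfInstance sfInstance_reg335_iff CvX CvX' cvM cvBlk CvNorm cvT sf_rows_cvT_exp_sub_one_le sf_cols_cvT_exp_sub_one_le
  gavgM_conjTranspose_of_skew)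
open Summit.QuantumFields.YangMills.BalabanUVNodes.N15.CovAvg (qvCov qvCovAdj qvCov_one qvCovAdj_one hasMaj_qvCov_sub_one hasMaj_qvCovAdj_sub_one)

/-! ## §1 Scalar letters: the exponential of 182 is linear in the field letter inside the window -/

section Scalar

/-- `e^x − 1 ≤ x·e^x` (all real `x`: `1 − x ≤ e^{−x}`); private copy of a folklore one-liner that a dozen tree files keep private (e.g. `B12Eq311RemainderQuadratic`,
`B5CombesThomasLatticeSolve`) — kept private here too rather than importing an unrelated module for it. [folklore] -/
private theorem exp_sub_one_le_mul_exp (x : ℝ) : Real.exp x - 1 ≤ x * Real.exp x := by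
  have h3 := Real.one_sub_le_exp_neg x
  have h4 : Real.exp x * Real.exp (-x) = 1 := by rw [← Real.exp_add, add_neg_cancel, Real.exp_zero]
  nlinarith [Real.exp_pos x, mul_le_mul_of_nonneg_left h3 (Real.exp_pos x).le]

/-- `(1+x)^N − 1 ≤ (N x)·e^{N x}` for `x ≥ 0`. [folklore] -/
theorem pow_sub_one_le_mul_exp {x : ℝ} (hx : 0 ≤ x) (N : ℕ) : (1 + x) ^ N - 1 ≤ ((N : ℝ) * x) * Real.exp ((N : ℝ) * x) := by
  have h1 : (1 + x) ^ N ≤ Real.exp ((N : ℝ) * x) := by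
    rw [Real.exp_nat_mul]
    exact pow_le_pow_left₀ (by positivity) (by linarith [Real.add_one_le_exp x]) N
  have h2 := exp_sub_one_le_mul_exp ((N : ℝ) * x)
  linarith

/-- ★ **THE TRANSPORT SIZE IS LINEAR IN THE FIELD LETTER INSIDE THE WINDOW**: if the transporters' row-closeness is `ρ_T ≤ C·(e^{ηr_A} − 1)` with `nη = 1` and `0 ≤ r_A ≤ 1`, then
`(1+ρ_T)^{(d+2)n} − 1 ≤ K_Q·r_A`, `K_Q = (d+2)·C·e·e^{(d+2)·C·e}`. [folklore] -/
theorem transport_size_le {d n : ℕ} {C η rA ρT : ℝ} (hC : 0 ≤ C) (hη : 0 ≤ η) (hη1 : η ≤ 1) (hrA : 0 ≤ rA) (hrA1 : rA ≤ 1) (hnη : (n : ℝ) * η = 1) (hρT0 : 0 ≤ ρT)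
    (hρT : ρT ≤ C * (Real.exp (η * rA) - 1)) :
    (1 + ρT) ^ ((d + 2) * n) - 1 ≤ ((d + 2 : ℝ) * C * Real.exp 1 * Real.exp ((d + 2 : ℝ) * C * Real.exp 1)) * rA := by
  have hηrA : η * rA ≤ 1 := by
    calc η * rA ≤ 1 * 1 := mul_le_mul hη1 hrA1 hrA zero_le_one
      _ = 1 := one_mul 1
  -- `e^{ηr_A} − 1 ≤ ηr_A·e`
  have h1 : Real.exp (η * rA) - 1 ≤ η * rA * Real.exp 1 :=
    (exp_sub_one_le_mul_exp (η * rA)).trans (mul_le_mul_of_nonneg_left (Real.exp_le_exp.mpr hηrA) (by positivity))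
  have hρT' : ρT ≤ C * (η * rA * Real.exp 1) := hρT.trans (mul_le_mul_of_nonneg_left h1 hC)
  -- `NρT ≤ (d+2)·C·e·r_A ≤ (d+2)·C·e`
  have hN : (((d + 2) * n : ℕ) : ℝ) * ρT ≤ (d + 2 : ℝ) * C * Real.exp 1 * rA := by
    have h := mul_le_mul_of_nonneg_left hρT' (show (0 : ℝ) ≤ (((d + 2) * n : ℕ) : ℝ) by positivity)
    calc (((d + 2) * n : ℕ) : ℝ) * ρT ≤ (((d + 2) * n : ℕ) : ℝ) * (C * (η * rA * Real.exp 1)) := h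
      _ = (d + 2 : ℝ) * C * Real.exp 1 * rA * ((n : ℝ) * η) := by push_cast; ring
      _ = (d + 2 : ℝ) * C * Real.exp 1 * rA := by rw [hnη, mul_one]
  have hN1 : (((d + 2) * n : ℕ) : ℝ) * ρT ≤ (d + 2 : ℝ) * C * Real.exp 1 := by
    calc (((d + 2) * n : ℕ) : ℝ) * ρT ≤ (d + 2 : ℝ) * C * Real.exp 1 * rA := hN
      _ ≤ (d + 2 : ℝ) * C * Real.exp 1 * 1 := mul_le_mul_of_nonneg_left hrA1 (by positivity)
      _ = _ := mul_one _
  have hP := pow_sub_one_le_mul_exp hρT0 ((d + 2) * n)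
  have hE : Real.exp ((((d + 2) * n : ℕ) : ℝ) * ρT) ≤ Real.exp ((d + 2 : ℝ) * C * Real.exp 1) := Real.exp_le_exp.mpr hN1
  calc (1 + ρT) ^ ((d + 2) * n) - 1 ≤ ((((d + 2) * n : ℕ) : ℝ) * ρT) * Real.exp ((((d + 2) * n : ℕ) : ℝ) * ρT) := hP
    _ ≤ ((d + 2 : ℝ) * C * Real.exp 1 * rA) * Real.exp ((d + 2 : ℝ) * C * Real.exp 1) := mul_le_mul hN hE (Real.exp_nonneg _) (by positivity)
    _ = _ := by ring

end Scalar

/-! ## §1b The Euclidean operator norm is bounded by the Frobenius norm (the class `Reg335` of `sfInstance` is Frobenius; n15-c∕187a's transporter letter is L²-operator) -/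

section NormBridge

open scoped Matrix.Norms.L2Operator
open WithLp

/-- ★ **`‖M‖_{op} ≤ ‖M‖_F`** for a complex square matrix (Cauchy–Schwarz row by row; the right-hand norm is Mathlib's Frobenius instance, written explicitly since this section's
instance is the L²-operator one). [folklore] -/
theorem l2_opNorm_le_frobeniusNorm {m : Type} [Fintype m] [DecidableEq m] (M : Matrix m m ℂ) :
    ‖M‖ ≤ @Norm.norm _ Matrix.frobeniusSeminormedAddCommGroup.toNorm M := by
  have hF : @Norm.norm _ Matrix.frobeniusSeminormedAddCommGroup.toNorm M = Real.sqrt (∑ i, ∑ j, ‖M i j‖ ^ 2) := by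
    rw [@Matrix.frobenius_norm_def, ← Real.sqrt_eq_rpow]
    simp_rw [Real.rpow_two]
  rw [hF, Matrix.l2_opNorm_def]
  refine ContinuousLinearMap.opNorm_le_bound _ (Real.sqrt_nonneg _) fun x => ?_
  have h0 : 0 ≤ ∑ i, ∑ j, ‖M i j‖ ^ 2 := Finset.sum_nonneg fun i _ => Finset.sum_nonneg fun j _ => by positivity
  refine (pow_le_pow_iff_left₀ (norm_nonneg _) (mul_nonneg (Real.sqrt_nonneg _) (norm_nonneg _)) two_ne_zero).1 ?_
  show ‖(toLp 2 (M *ᵥ ofLp x) : EuclideanSpace ℂ m)‖ ^ 2 ≤ (Real.sqrt (∑ i, ∑ j, ‖M i j‖ ^ 2) * ‖x‖) ^ 2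
  rw [mul_pow, Real.sq_sqrt h0, EuclideanSpace.norm_sq_eq]
  have hx : ‖x‖ ^ 2 = ∑ j, ‖ofLp x j‖ ^ 2 := by rw [EuclideanSpace.norm_sq_eq]
  have hrow : ∀ i, ‖(toLp 2 (M *ᵥ ofLp x) : EuclideanSpace ℂ m) i‖ ^ 2 ≤ (∑ j, ‖M i j‖ ^ 2) * ∑ j, ‖ofLp x j‖ ^ 2 := by
    intro i
    have e : (toLp 2 (M *ᵥ ofLp x) : EuclideanSpace ℂ m) i = ∑ j, M i j * ofLp x j := by
      simp only [Matrix.mulVec, dotProduct]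
    rw [e]
    calc ‖∑ j, M i j * ofLp x j‖ ^ 2 ≤ (∑ j, ‖M i j‖ * ‖ofLp x j‖) ^ 2 := by
          gcongr; exact (norm_sum_le _ _).trans (le_of_eq (Finset.sum_congr rfl fun j _ => norm_mul _ _))
      _ ≤ (∑ j, ‖M i j‖ ^ 2) * ∑ j, ‖ofLp x j‖ ^ 2 := Finset.sum_mul_sq_le_sq_mul_sq _ _ _
  calc ∑ i, ‖(toLp 2 (M *ᵥ ofLp x) : EuclideanSpace ℂ m) i‖ ^ 2
      ≤ ∑ i, (∑ j, ‖M i j‖ ^ 2) * ∑ j, ‖ofLp x j‖ ^ 2 := Finset.sum_le_sum fun i _ => hrow i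
    _ = (∑ i, ∑ j, ‖M i j‖ ^ 2) * ‖x‖ ^ 2 := by rw [Finset.sum_mul, hx]

end NormBridge

variable (d : ℕ) {L : ℕ} [NeZero L] (mm ι : Type) [Fintype mm] [DecidableEq mm] [Fintype ι] [DecidableEq ι] (e : Matrix mm mm ℂ ≃L[ℝ] (ι → ℝ))

/-! ## §2 The constructed averaging-perturbation family of dag-n15-c's `Q(U)` -/

section Family

open scoped Matrix.Norms.L2Operator

/-- THE COARSE TRANSPORTER DATUM: `T_c(A′) = cvT e (e^{ηĀ′})`, `η = L^{−k}`, `Ā′ = gavgM π̂ A′` the block mean (dag-n15-c's coarse partner). [cite: Balaban1985BackgroundPropagators, (3.50) p.400 (shape)] -/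
def qTc (hL : Odd L ∧ 1 < L) (i : SfIdx d L) (A' : Fin (d + 1) → CvX' d L i.m i.kk i.r hL → Matrix mm mm ℂ) : Fin (d + 1) → CvX d L i.m i.kk hL → Matrix ι ι ℝ :=
  cvT e (fun μ x => NormedSpace.exp (((((L ^ i.kk : ℕ) : ℝ))⁻¹) • gavgM (Matrix mm mm ℂ) (Fin (d + 1)) (kingPrV L i.kk i.r (cvM d L i.m i.kk hL)) A' μ x))

/-- THE FINE TRANSPORTER DATUM: `T_f(A′) = cvT e (e^{η′A′})`, `η′ = L^{−(r+k)}`. [cite: Balaban1985BackgroundPropagators, (3.50) p.400 (shape)] -/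
def qTf (hL : Odd L ∧ 1 < L) (i : SfIdx d L) (A' : Fin (d + 1) → CvX' d L i.m i.kk i.r hL → Matrix mm mm ℂ) : Fin (d + 1) → CvX' d L i.m i.kk i.r hL → Matrix ι ι ℝ :=
  cvT e (fun μ x' => NormedSpace.exp (((((L ^ i.r * L ^ i.kk : ℕ) : ℝ))⁻¹) • A' μ x'))

/-- `D_c(A′) = Q_{T_c(A′)} − Q ⊗ 1_ι` (coarse). [cite: Balaban1985BackgroundPropagators, (3.80) p.406 (`F₂ = Q(U′U) − Q(U)`: shape)] -/
def qDc (hL : Odd L ∧ 1 < L) (i : SfIdx d L) (A' : Fin (d + 1) → CvX' d L i.m i.kk i.r hL → Matrix mm mm ℂ) :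
    (CvX d L i.m i.kk hL × ι → ℝ) →ₗ[ℝ] ((Tor (cvM d L i.m i.kk hL) × Fin (d + 1)) × ι → ℝ) :=
  qvCov (cvM d L i.m i.kk hL) (L ^ i.kk) (qTc d mm ι e hL i A') - tensorId ι (qvRe (cvM d L i.m i.kk hL) (L ^ i.kk))

/-- `E_c(A′) = Q*_{T_c(A′)} − Q* ⊗ 1_ι` (coarse). [cite: Balaban1985BackgroundPropagators, (3.80) p.406 (`F*₂`: shape)] -/
def qEc (hL : Odd L ∧ 1 < L) (i : SfIdx d L) (A' : Fin (d + 1) → CvX' d L i.m i.kk i.r hL → Matrix mm mm ℂ) :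
    ((Tor (cvM d L i.m i.kk hL) × Fin (d + 1)) × ι → ℝ) →ₗ[ℝ] (CvX d L i.m i.kk hL × ι → ℝ) :=
  qvCovAdj (cvM d L i.m i.kk hL) (L ^ i.kk) (qTc d mm ι e hL i A') - tensorId ι (qvAdjRe (cvM d L i.m i.kk hL) (L ^ i.kk))

/-- `D_f(A′) = Q′_{T_f(A′)} − Q′ ⊗ 1_ι` (fine). [cite: Balaban1985BackgroundPropagators, (3.80) p.406 (shape)] -/
def qDf (hL : Odd L ∧ 1 < L) (i : SfIdx d L) (A' : Fin (d + 1) → CvX' d L i.m i.kk i.r hL → Matrix mm mm ℂ) :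
    (CvX' d L i.m i.kk i.r hL × ι → ℝ) →ₗ[ℝ] ((Tor (cvM d L i.m i.kk hL) × Fin (d + 1)) × ι → ℝ) :=
  qvCov (cvM d L i.m i.kk hL) (L ^ i.r * L ^ i.kk) (qTf d mm ι e hL i A') - tensorId ι (qvRe (cvM d L i.m i.kk hL) (L ^ i.r * L ^ i.kk))

/-- `E_f(A′) = Q′*_{T_f(A′)} − Q′* ⊗ 1_ι` (fine). [cite: Balaban1985BackgroundPropagators, (3.80) p.406 (shape)] -/
def qEf (hL : Odd L ∧ 1 < L) (i : SfIdx d L) (A' : Fin (d + 1) → CvX' d L i.m i.kk i.r hL → Matrix mm mm ℂ) :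
    ((Tor (cvM d L i.m i.kk hL) × Fin (d + 1)) × ι → ℝ) →ₗ[ℝ] (CvX' d L i.m i.kk i.r hL × ι → ℝ) :=
  qvCovAdj (cvM d L i.m i.kk hL) (L ^ i.r * L ^ i.kk) (qTf d mm ι e hL i A') - tensorId ι (qvAdjRe (cvM d L i.m i.kk hL) (L ^ i.r * L ^ i.kk))

/-- `D_c = Q_{T_c} − Q_1`. [bookkeeping] -/
theorem qDc_eq (hL : Odd L ∧ 1 < L) (i : SfIdx d L) (A' : Fin (d + 1) → CvX' d L i.m i.kk i.r hL → Matrix mm mm ℂ) :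
    qDc d mm ι e hL i A' = qvCov (cvM d L i.m i.kk hL) (L ^ i.kk) (qTc d mm ι e hL i A') - qvCov (cvM d L i.m i.kk hL) (L ^ i.kk) (fun _ _ => 1) := by
  rw [qDc, qvCov_one]

/-- `E_c = Q*_{T_c} − Q*_1`. [bookkeeping] -/
theorem qEc_eq (hL : Odd L ∧ 1 < L) (i : SfIdx d L) (A' : Fin (d + 1) → CvX' d L i.m i.kk i.r hL → Matrix mm mm ℂ) :
    qEc d mm ι e hL i A' = qvCovAdj (cvM d L i.m i.kk hL) (L ^ i.kk) (qTc d mm ι e hL i A') - qvCovAdj (cvM d L i.m i.kk hL) (L ^ i.kk) (fun _ _ => 1) := by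
  rw [qEc, qvCovAdj_one]

/-- `D_f = Q′_{T_f} − Q′_1`. [bookkeeping] -/
theorem qDf_eq (hL : Odd L ∧ 1 < L) (i : SfIdx d L) (A' : Fin (d + 1) → CvX' d L i.m i.kk i.r hL → Matrix mm mm ℂ) :
    qDf d mm ι e hL i A' = qvCov (cvM d L i.m i.kk hL) (L ^ i.r * L ^ i.kk) (qTf d mm ι e hL i A') - qvCov (cvM d L i.m i.kk hL) (L ^ i.r * L ^ i.kk) (fun _ _ => 1) := by
  rw [qDf, qvCov_one]

/-- `E_f = Q′*_{T_f} − Q′*_1`. [bookkeeping] -/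
theorem qEf_eq (hL : Odd L ∧ 1 < L) (i : SfIdx d L) (A' : Fin (d + 1) → CvX' d L i.m i.kk i.r hL → Matrix mm mm ℂ) :
    qEf d mm ι e hL i A' = qvCovAdj (cvM d L i.m i.kk hL) (L ^ i.r * L ^ i.kk) (qTf d mm ι e hL i A') - qvCovAdj (cvM d L i.m i.kk hL) (L ^ i.r * L ^ i.kk) (fun _ _ => 1) := by
  rw [qEf, qvCovAdj_one]

end Family


/-! ## §2b The block mean stays in the Frobenius ball of the class -/

section FrobeniusFacts

open scoped Matrix.Norms.Frobenius

/-- Under `Reg335 c₃₅ α₀ A′` (Frobenius currency of dag-n15-c's carrier) the block-mean field has Frobenius size `≤ c₃₅L^mα₀` (`norm_blockAvgV_le`). [folklore] -/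
theorem norm_gavgM_le_of_norm_le (hL : Odd L ∧ 1 < L) (i : SfIdx d L) {A' : Fin (d + 1) → CvX' d L i.m i.kk i.r hL → Matrix mm mm ℂ} {r : ℝ} (hr : 0 ≤ r)
    (hA : ∀ μ x', ‖A' μ x'‖ ≤ r) (μ : Fin (d + 1)) (x : CvX d L i.m i.kk hL) :
    ‖gavgM (Matrix mm mm ℂ) (Fin (d + 1)) (kingPrV L i.kk i.r (cvM d L i.m i.kk hL)) A' μ x‖ ≤ r :=
  norm_blockAvgV_le (kingPrV L i.kk i.r (cvM d L i.m i.kk hL)) hr (hA μ) x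

end FrobeniusFacts

/-! ## §3 ★★ The four size rows -/

section Sizes

open scoped Matrix.Norms.L2Operator

variable [Nonempty mm]

/-- The transporters' row∕column closeness constant `C_T = |ι|·κ_e·2√m·√m`. [bookkeeping] -/
def cT : ℝ := Fintype.card ι * (@basisConst ι _ (Matrix mm mm ℂ) Matrix.frobeniusNormedAddCommGroup Matrix.frobeniusNormedSpace e * (2 * Real.sqrt (Fintype.card mm)) * Real.sqrt (Fintype.card mm))

omit [DecidableEq mm] [DecidableEq ι] in
/-- `0 ≤ C_T`. [folklore] -/
theorem cT_nonneg : 0 ≤ cT mm ι e := by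
  unfold cT
  have := @basisConst_nonneg ι _ (Matrix mm mm ℂ) Matrix.frobeniusNormedAddCommGroup Matrix.frobeniusNormedSpace e
  positivity

/-- The size constant `K_Q(ρ) := (d+2)·C_T·e·e^{(d+2)·C_T·e}·e^{ρ}`. [bookkeeping] -/
def kQ (ρ : ℝ) : ℝ := (d + 2 : ℝ) * cT mm ι e * Real.exp 1 * Real.exp ((d + 2 : ℝ) * cT mm ι e * Real.exp 1) * Real.exp ρ

omit [DecidableEq mm] [DecidableEq ι] in
/-- `0 ≤ K_Q(ρ)`. [folklore] -/
theorem kQ_nonneg (ρ : ℝ) : 0 ≤ kQ d mm ι e ρ := by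
  unfold kQ; have := cT_nonneg mm ι e; positivity

/-- ★★ **SIZE ROW OF `D_c`**: under `Reg335 c₃₅ α₀ A′` with `c₃₅L^mα₀ ≤ 1`, `D_c(A′) ≤ K_Q(ρ)·(c₃₅L^mα₀)·e^{−ρd}` blockwise (coarse coloured 1-forms → unit), every `ρ ≥ 0`.
[cite: Balaban1985BackgroundPropagators, (3.81) p.406 (shape `O(1)α₁`); Balaban1985Averaging, (126) p.36] -/
theorem hasMaj_qDc (hL : Odd L ∧ 1 < L) {c35 : ℝ} (hc35 : 0 ≤ c35) {ρ : ℝ} (hρ : 0 ≤ ρ) (i : SfIdx d L) {α₀ : ℝ} (hα₀ : 0 < α₀)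
    (hr1 : c35 * (L : ℝ) ^ i.m * α₀ ≤ 1) {A' : Fin (d + 1) → CvX' d L i.m i.kk i.r hL → Matrix mm mm ℂ} (hA' : (sfInstance d mm ι hL i).Bf.Reg335 c35 α₀ A') :
    HasMaj (CvNorm d L i.m i.kk hL ι) (BlockNorm.ofBlocks (unitTorusGeo L i.kk (cvM d L i.m i.kk hL)) (liftBlk (fun b : Tor (cvM d L i.m i.kk hL) × Fin (d + 1) => b.1) ι)) (qDc d mm ι e hL i A')
      (fun y y' => kQ d mm ι e ρ * (c35 * (L : ℝ) ^ i.m * α₀) * Real.exp (-(ρ * (unitTorusGeo L i.kk (cvM d L i.m i.kk hL)).dist y y'))) := by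
  have hLpos : 0 < L := Nat.pos_of_ne_zero (NeZero.ne L)
  obtain ⟨hskew, h1, -, -⟩ := (sfInstance_reg335_iff d mm ι hL i c35 α₀ A').1 hA'
  have hrA0 : 0 ≤ c35 * (L : ℝ) ^ i.m * α₀ := by positivity
  set η : ℝ := ((((L ^ i.kk : ℕ) : ℝ))⁻¹) with hη
  have hη0 : 0 ≤ η := by positivity
  have hnη : ((L ^ i.kk : ℕ) : ℝ) * η = 1 := mul_inv_cancel₀ (by exact_mod_cast (pow_pos hLpos _).ne')
  have hAm : ∀ μ x, (gavgM (Matrix mm mm ℂ) (Fin (d + 1)) (kingPrV L i.kk i.r (cvM d L i.m i.kk hL)) A' μ x)ᴴ = -gavgM (Matrix mm mm ℂ) (Fin (d + 1)) (kingPrV L i.kk i.r (cvM d L i.m i.kk hL)) A' μ x :=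
    gavgM_conjTranspose_of_skew (kingPrV L i.kk i.r (cvM d L i.m i.kk hL)) hskew
  have hAnOp : ∀ μ x, ‖gavgM (Matrix mm mm ℂ) (Fin (d + 1)) (kingPrV L i.kk i.r (cvM d L i.m i.kk hL)) A' μ x‖ ≤ c35 * (L : ℝ) ^ i.m * α₀ :=
    fun μ x => (l2_opNorm_le_frobeniusNorm _).trans (norm_gavgM_le_of_norm_le d mm hL i hrA0 h1 μ x)
  have hT : ∀ μ p ii, ∑ j, |(qTc d mm ι e hL i A' μ p - 1) ii j| ≤ cT mm ι e * (Real.exp (η * (c35 * (L : ℝ) ^ i.m * α₀)) - 1) := fun μ p ii =>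
    (sf_rows_cvT_exp_sub_one_le e hη0 hAm hAnOp μ p ii).trans (le_of_eq (by unfold cT; ring))
  have hρT0 : 0 ≤ cT mm ι e * (Real.exp (η * (c35 * (L : ℝ) ^ i.m * α₀)) - 1) :=
    mul_nonneg (cT_nonneg mm ι e) (by have := Real.add_one_le_exp (η * (c35 * (L : ℝ) ^ i.m * α₀)); nlinarith [mul_nonneg hη0 hrA0])
  have h := hasMaj_qvCov_sub_one (L := L) (cvM d L i.m i.kk hL) i.kk (L ^ i.kk) hρT0 hρ hT
  rw [← qDc_eq] at h
  refine h.mono fun y y' => mul_le_mul_of_nonneg_right ?_ (Real.exp_nonneg _)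
  have hη1 : η ≤ 1 := inv_le_one_of_one_le₀ (by exact_mod_cast Nat.one_le_pow _ _ hLpos)
  have hs := transport_size_le (d := d) (n := L ^ i.kk) (cT_nonneg mm ι e) hη0 hη1 hrA0 hr1 hnη hρT0 le_rfl
  calc ((1 + cT mm ι e * (Real.exp (η * (c35 * (L : ℝ) ^ i.m * α₀)) - 1)) ^ ((d + 2) * L ^ i.kk) - 1) * Real.exp ρ
      ≤ ((d + 2 : ℝ) * cT mm ι e * Real.exp 1 * Real.exp ((d + 2 : ℝ) * cT mm ι e * Real.exp 1) * (c35 * (L : ℝ) ^ i.m * α₀)) * Real.exp ρ :=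
        mul_le_mul_of_nonneg_right hs (Real.exp_nonneg _)
    _ = kQ d mm ι e ρ * (c35 * (L : ℝ) ^ i.m * α₀) := by unfold kQ; ring

/-- ★★ **SIZE ROW OF `E_c`**: under `Reg335 c₃₅ α₀ A′` with `c₃₅L^mα₀ ≤ 1`, `E_c(A′) ≤ K_Q(ρ)·(c₃₅L^mα₀)·e^{−ρd}` blockwise (unit → coarse coloured 1-forms), every `ρ ≥ 0`.
[cite: Balaban1985BackgroundPropagators, (3.81) p.406 (shape `O(1)α₁`); Balaban1985Averaging, (126) p.36] -/
theorem hasMaj_qEc (hL : Odd L ∧ 1 < L) {c35 : ℝ} (hc35 : 0 ≤ c35) {ρ : ℝ} (hρ : 0 ≤ ρ) (i : SfIdx d L) {α₀ : ℝ} (hα₀ : 0 < α₀)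
    (hr1 : c35 * (L : ℝ) ^ i.m * α₀ ≤ 1) {A' : Fin (d + 1) → CvX' d L i.m i.kk i.r hL → Matrix mm mm ℂ} (hA' : (sfInstance d mm ι hL i).Bf.Reg335 c35 α₀ A') :
    HasMaj (BlockNorm.ofBlocks (unitTorusGeo L i.kk (cvM d L i.m i.kk hL)) (liftBlk (fun b : Tor (cvM d L i.m i.kk hL) × Fin (d + 1) => b.1) ι)) (CvNorm d L i.m i.kk hL ι) (qEc d mm ι e hL i A')
      (fun y y' => kQ d mm ι e ρ * (c35 * (L : ℝ) ^ i.m * α₀) * Real.exp (-(ρ * (unitTorusGeo L i.kk (cvM d L i.m i.kk hL)).dist y y'))) := by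
  have hLpos : 0 < L := Nat.pos_of_ne_zero (NeZero.ne L)
  obtain ⟨hskew, h1, -, -⟩ := (sfInstance_reg335_iff d mm ι hL i c35 α₀ A').1 hA'
  have hrA0 : 0 ≤ c35 * (L : ℝ) ^ i.m * α₀ := by positivity
  set η : ℝ := ((((L ^ i.kk : ℕ) : ℝ))⁻¹) with hη
  have hη0 : 0 ≤ η := by positivity
  have hnη : ((L ^ i.kk : ℕ) : ℝ) * η = 1 := mul_inv_cancel₀ (by exact_mod_cast (pow_pos hLpos _).ne')
  have hAm : ∀ μ x, (gavgM (Matrix mm mm ℂ) (Fin (d + 1)) (kingPrV L i.kk i.r (cvM d L i.m i.kk hL)) A' μ x)ᴴ = -gavgM (Matrix mm mm ℂ) (Fin (d + 1)) (kingPrV L i.kk i.r (cvM d L i.m i.kk hL)) A' μ x :=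
    gavgM_conjTranspose_of_skew (kingPrV L i.kk i.r (cvM d L i.m i.kk hL)) hskew
  have hAnOp : ∀ μ x, ‖gavgM (Matrix mm mm ℂ) (Fin (d + 1)) (kingPrV L i.kk i.r (cvM d L i.m i.kk hL)) A' μ x‖ ≤ c35 * (L : ℝ) ^ i.m * α₀ :=
    fun μ x => (l2_opNorm_le_frobeniusNorm _).trans (norm_gavgM_le_of_norm_le d mm hL i hrA0 h1 μ x)
  have hT : ∀ μ p jj, ∑ ii, |(qTc d mm ι e hL i A' μ p - 1) ii jj| ≤ cT mm ι e * (Real.exp (η * (c35 * (L : ℝ) ^ i.m * α₀)) - 1) := fun μ p jj =>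
    (sf_cols_cvT_exp_sub_one_le e hη0 hAm hAnOp μ p jj).trans (le_of_eq (by unfold cT; ring))
  have hρT0 : 0 ≤ cT mm ι e * (Real.exp (η * (c35 * (L : ℝ) ^ i.m * α₀)) - 1) :=
    mul_nonneg (cT_nonneg mm ι e) (by have := Real.add_one_le_exp (η * (c35 * (L : ℝ) ^ i.m * α₀)); nlinarith [mul_nonneg hη0 hrA0])
  have h := hasMaj_qvCovAdj_sub_one (L := L) (cvM d L i.m i.kk hL) i.kk (L ^ i.kk) hρT0 hρ hT
  rw [← qEc_eq] at h
  refine h.mono fun y y' => mul_le_mul_of_nonneg_right ?_ (Real.exp_nonneg _)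
  have hη1 : η ≤ 1 := inv_le_one_of_one_le₀ (by exact_mod_cast Nat.one_le_pow _ _ hLpos)
  have hs := transport_size_le (d := d) (n := L ^ i.kk) (cT_nonneg mm ι e) hη0 hη1 hrA0 hr1 hnη hρT0 le_rfl
  calc ((1 + cT mm ι e * (Real.exp (η * (c35 * (L : ℝ) ^ i.m * α₀)) - 1)) ^ ((d + 2) * L ^ i.kk) - 1) * Real.exp ρ
      ≤ ((d + 2 : ℝ) * cT mm ι e * Real.exp 1 * Real.exp ((d + 2 : ℝ) * cT mm ι e * Real.exp 1) * (c35 * (L : ℝ) ^ i.m * α₀)) * Real.exp ρ :=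
        mul_le_mul_of_nonneg_right hs (Real.exp_nonneg _)
    _ = kQ d mm ι e ρ * (c35 * (L : ℝ) ^ i.m * α₀) := by unfold kQ; ring

/-- ★★ **SIZE ROW OF `D_f`**: under `Reg335 c₃₅ α₀ A′` with `c₃₅L^mα₀ ≤ 1`, `D_f(A′) ≤ K_Q(ρ)·(c₃₅L^mα₀)·e^{−ρd}` blockwise (fine coloured 1-forms → unit), every `ρ ≥ 0`.
[cite: Balaban1985BackgroundPropagators, (3.81) p.406 (shape `O(1)α₁`); Balaban1985Averaging, (126) p.36] -/
theorem hasMaj_qDf (hL : Odd L ∧ 1 < L) {c35 : ℝ} (hc35 : 0 ≤ c35) {ρ : ℝ} (hρ : 0 ≤ ρ) (i : SfIdx d L) {α₀ : ℝ} (hα₀ : 0 < α₀)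
    (hr1 : c35 * (L : ℝ) ^ i.m * α₀ ≤ 1) {A' : Fin (d + 1) → CvX' d L i.m i.kk i.r hL → Matrix mm mm ℂ} (hA' : (sfInstance d mm ι hL i).Bf.Reg335 c35 α₀ A') :
    HasMaj (BlockNorm.ofBlocks (unitTorusGeo L i.kk (cvM d L i.m i.kk hL)) (liftBlk (fun b : CvX' d L i.m i.kk i.r hL => blockOf (L ^ i.r * L ^ i.kk) (cvM d L i.m i.kk hL) b.1) ι))
      (BlockNorm.ofBlocks (unitTorusGeo L i.kk (cvM d L i.m i.kk hL)) (liftBlk (fun b : Tor (cvM d L i.m i.kk hL) × Fin (d + 1) => b.1) ι)) (qDf d mm ι e hL i A')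
      (fun y y' => kQ d mm ι e ρ * (c35 * (L : ℝ) ^ i.m * α₀) * Real.exp (-(ρ * (unitTorusGeo L i.kk (cvM d L i.m i.kk hL)).dist y y'))) := by
  have hLpos : 0 < L := Nat.pos_of_ne_zero (NeZero.ne L)
  obtain ⟨hskew, h1, -, -⟩ := (sfInstance_reg335_iff d mm ι hL i c35 α₀ A').1 hA'
  have hrA0 : 0 ≤ c35 * (L : ℝ) ^ i.m * α₀ := by positivity
  set η : ℝ := ((((L ^ i.r * L ^ i.kk : ℕ) : ℝ))⁻¹) with hη
  have hη0 : 0 ≤ η := by positivity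
  have hpos : 0 < L ^ i.r * L ^ i.kk := Nat.mul_pos (pow_pos hLpos _) (pow_pos hLpos _)
  have hnη : ((L ^ i.r * L ^ i.kk : ℕ) : ℝ) * η = 1 := mul_inv_cancel₀ (by exact_mod_cast hpos.ne')
  have hAOp : ∀ μ x', ‖A' μ x'‖ ≤ c35 * (L : ℝ) ^ i.m * α₀ := fun μ x' => (l2_opNorm_le_frobeniusNorm _).trans (h1 μ x')
  have hT : ∀ μ p ii, ∑ j, |(qTf d mm ι e hL i A' μ p - 1) ii j| ≤ cT mm ι e * (Real.exp (η * (c35 * (L : ℝ) ^ i.m * α₀)) - 1) := fun μ p ii =>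
    (sf_rows_cvT_exp_sub_one_le e hη0 hskew hAOp μ p ii).trans (le_of_eq (by unfold cT; ring))
  have hρT0 : 0 ≤ cT mm ι e * (Real.exp (η * (c35 * (L : ℝ) ^ i.m * α₀)) - 1) :=
    mul_nonneg (cT_nonneg mm ι e) (by have := Real.add_one_le_exp (η * (c35 * (L : ℝ) ^ i.m * α₀)); nlinarith [mul_nonneg hη0 hrA0])
  haveI : NeZero (L ^ i.r * L ^ i.kk) := ⟨hpos.ne'⟩
  have h := hasMaj_qvCov_sub_one (L := L) (cvM d L i.m i.kk hL) i.kk (L ^ i.r * L ^ i.kk) hρT0 hρ hT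
  rw [← qDf_eq] at h
  refine h.mono fun y y' => mul_le_mul_of_nonneg_right ?_ (Real.exp_nonneg _)
  have hη1 : η ≤ 1 := inv_le_one_of_one_le₀ (by exact_mod_cast hpos)
  have hs := transport_size_le (d := d) (n := L ^ i.r * L ^ i.kk) (cT_nonneg mm ι e) hη0 hη1 hrA0 hr1 hnη hρT0 le_rfl
  calc ((1 + cT mm ι e * (Real.exp (η * (c35 * (L : ℝ) ^ i.m * α₀)) - 1)) ^ ((d + 2) * (L ^ i.r * L ^ i.kk)) - 1) * Real.exp ρ
      ≤ ((d + 2 : ℝ) * cT mm ι e * Real.exp 1 * Real.exp ((d + 2 : ℝ) * cT mm ι e * Real.exp 1) * (c35 * (L : ℝ) ^ i.m * α₀)) * Real.exp ρ :=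
        mul_le_mul_of_nonneg_right hs (Real.exp_nonneg _)
    _ = kQ d mm ι e ρ * (c35 * (L : ℝ) ^ i.m * α₀) := by unfold kQ; ring

/-- ★★ **SIZE ROW OF `E_f`**: under `Reg335 c₃₅ α₀ A′` with `c₃₅L^mα₀ ≤ 1`, `E_f(A′) ≤ K_Q(ρ)·(c₃₅L^mα₀)·e^{−ρd}` blockwise (unit → fine coloured 1-forms), every `ρ ≥ 0`.
[cite: Balaban1985BackgroundPropagators, (3.81) p.406 (shape `O(1)α₁`); Balaban1985Averaging, (126) p.36] -/
theorem hasMaj_qEf (hL : Odd L ∧ 1 < L) {c35 : ℝ} (hc35 : 0 ≤ c35) {ρ : ℝ} (hρ : 0 ≤ ρ) (i : SfIdx d L) {α₀ : ℝ} (hα₀ : 0 < α₀)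
    (hr1 : c35 * (L : ℝ) ^ i.m * α₀ ≤ 1) {A' : Fin (d + 1) → CvX' d L i.m i.kk i.r hL → Matrix mm mm ℂ} (hA' : (sfInstance d mm ι hL i).Bf.Reg335 c35 α₀ A') :
    HasMaj (BlockNorm.ofBlocks (unitTorusGeo L i.kk (cvM d L i.m i.kk hL)) (liftBlk (fun b : Tor (cvM d L i.m i.kk hL) × Fin (d + 1) => b.1) ι))
      (BlockNorm.ofBlocks (unitTorusGeo L i.kk (cvM d L i.m i.kk hL)) (liftBlk (fun b : CvX' d L i.m i.kk i.r hL => blockOf (L ^ i.r * L ^ i.kk) (cvM d L i.m i.kk hL) b.1) ι)) (qEf d mm ι e hL i A')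
      (fun y y' => kQ d mm ι e ρ * (c35 * (L : ℝ) ^ i.m * α₀) * Real.exp (-(ρ * (unitTorusGeo L i.kk (cvM d L i.m i.kk hL)).dist y y'))) := by
  have hLpos : 0 < L := Nat.pos_of_ne_zero (NeZero.ne L)
  obtain ⟨hskew, h1, -, -⟩ := (sfInstance_reg335_iff d mm ι hL i c35 α₀ A').1 hA'
  have hrA0 : 0 ≤ c35 * (L : ℝ) ^ i.m * α₀ := by positivity
  set η : ℝ := ((((L ^ i.r * L ^ i.kk : ℕ) : ℝ))⁻¹) with hη
  have hη0 : 0 ≤ η := by positivity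
  have hpos : 0 < L ^ i.r * L ^ i.kk := Nat.mul_pos (pow_pos hLpos _) (pow_pos hLpos _)
  have hnη : ((L ^ i.r * L ^ i.kk : ℕ) : ℝ) * η = 1 := mul_inv_cancel₀ (by exact_mod_cast hpos.ne')
  have hAOp : ∀ μ x', ‖A' μ x'‖ ≤ c35 * (L : ℝ) ^ i.m * α₀ := fun μ x' => (l2_opNorm_le_frobeniusNorm _).trans (h1 μ x')
  have hT : ∀ μ p jj, ∑ ii, |(qTf d mm ι e hL i A' μ p - 1) ii jj| ≤ cT mm ι e * (Real.exp (η * (c35 * (L : ℝ) ^ i.m * α₀)) - 1) := fun μ p jj =>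
    (sf_cols_cvT_exp_sub_one_le e hη0 hskew hAOp μ p jj).trans (le_of_eq (by unfold cT; ring))
  have hρT0 : 0 ≤ cT mm ι e * (Real.exp (η * (c35 * (L : ℝ) ^ i.m * α₀)) - 1) :=
    mul_nonneg (cT_nonneg mm ι e) (by have := Real.add_one_le_exp (η * (c35 * (L : ℝ) ^ i.m * α₀)); nlinarith [mul_nonneg hη0 hrA0])
  haveI : NeZero (L ^ i.r * L ^ i.kk) := ⟨hpos.ne'⟩
  have h := hasMaj_qvCovAdj_sub_one (L := L) (cvM d L i.m i.kk hL) i.kk (L ^ i.r * L ^ i.kk) hρT0 hρ hT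
  rw [← qEf_eq] at h
  refine h.mono fun y y' => mul_le_mul_of_nonneg_right ?_ (Real.exp_nonneg _)
  have hη1 : η ≤ 1 := inv_le_one_of_one_le₀ (by exact_mod_cast hpos)
  have hs := transport_size_le (d := d) (n := L ^ i.r * L ^ i.kk) (cT_nonneg mm ι e) hη0 hη1 hrA0 hr1 hnη hρT0 le_rfl
  calc ((1 + cT mm ι e * (Real.exp (η * (c35 * (L : ℝ) ^ i.m * α₀)) - 1)) ^ ((d + 2) * (L ^ i.r * L ^ i.kk)) - 1) * Real.exp ρ
      ≤ ((d + 2 : ℝ) * cT mm ι e * Real.exp 1 * Real.exp ((d + 2 : ℝ) * cT mm ι e * Real.exp 1) * (c35 * (L : ℝ) ^ i.m * α₀)) * Real.exp ρ :=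
        mul_le_mul_of_nonneg_right hs (Real.exp_nonneg _)
    _ = kQ d mm ι e ρ * (c35 * (L : ℝ) ^ i.m * α₀) := by unfold kQ; ring

end Sizes

end Summit.QuantumFields.YangMills.BalabanUVNodes.N15.SiteLayerSf

end
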